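import Literature.MathematicalPhysics.QuantumFieldTheory.LatticeGaugeProofs
import Literature.Probability.LatticeModels.GibbsSpecificationTilted
import Literature.Probability.LatticeModels.GibbsSpecificationDLRProofs
import Literature.Probability.LatticeModels.ONModelSpecification
import HarnessLib

/-!
# The torus Wilson state is the full-volume Gibbs distribution of the plaquette potential

The finite-volume Wilson lattice gauge theory `wilsonMeasure ρ β` on the discrete torus
(`Literature/MathematicalPhysics/QuantumFieldTheory/ConstructiveQFTWave0.lean`) is a Gibbs
reweighting of product Haar measure by `exp (-β S_W)`, and the Wilson action
`S_W = ∑ₚ (N - Re tr ρ(U_p))` is the full-volume Hamiltonian of the nearest-neighbour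
(plaquette) potential on the FINITE link set of the torus.  Consequently the torus Wilson state
is the full-volume kernel `γ_{univ}(· | η)` of the Gibbsian specification of that potential
(tree `gibbsSpecOfPotential`, Georgii 2011 Def. 2.9) and hence a DLR state for it
(`IsGibbsMeasure`), so that the specification kernels `γ_Λ` are versions of its conditional
expectations given the links off `Λ` (`IsGibbsMeasure.condExp_ae_eq_integral`), and these
versions are LOCAL: `γ_Λ f` reads the boundary condition only on the links of plaquettes
touching `Λ` (the Markov property of a finite-range interaction).

## Contents (theorems only; no definition, no named fact)

General finite-volume facts about Gibbsian kernels `(ν^{⊗Λ} ∘ glueWith⁻¹).tilted φ`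
(Georgii 2011, Def. 1.23, Def. 2.9; Friedli–Velenik 2017, §6.3, §6.10.1):
* `map_glueWith_univ_pi` — gluing over the whole (finite) site set is the product measure;
  `gibbsSpecOfPotential_univ` — the full-volume kernel is `ν^{⊗V}` tilted by `-β H_V`;
* `IsSpecification.isGibbsMeasure_univ` — for a finite site set, every full-volume kernel
  `γ_{univ}(· | η)` of a specification is a Gibbs measure for it (consistency = DLR);
* `dependsOn_integral_tilted_map_glueWith_pi`, `dependsOn_integral_gibbsSpecOfPotential` —
  LOCALITY of the kernels: if the energy of `Λ` and the observable read only the spins in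
  `Λ ∪ T`, then `η ↦ γ_Λ f (η)` reads only the spins in `T`;
* `IsSpecification.stronglyMeasurable_cylinderEvents_integral` — hence `γ_Λ f` is
  `𝓕_T`-(strongly) measurable; `stronglyMeasurable_and_ae_eq_condExp_integral_gibbsSpecOfPotential`
  — the MARKOV PROPERTY: for a Gibbs measure `μ` of `γ^Φ`, `γ_Λ f` is an `𝓕_T`-measurable
  version of `μ[f | 𝓕_{Λᶜ}]`.

The torus Wilson theory (Wilson 1974; Seiler LNP 159 Ch. 1–2; Chatterjee arXiv:1803.01950 §2–3):
* `wilsonMeasure_eq_tilted_pi` — `μ_{Λ,β} = (Haar^{⊗ links}).tilted (-β S_W)`;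
* `exists_plaquettePotential` — the plaquette potential: adapted, bounded, finitely supported,
  with full-volume Hamiltonian `S_W`, interaction sets = edge sets of plaquettes;
* `wilsonMeasure_eq_gibbsSpecOfPotential_univ`, `isGibbsMeasure_wilsonMeasure` — the torus
  Wilson state is the full-volume Gibbs distribution, hence a DLR state, of any bounded adapted
  finitely supported potential whose full-volume Hamiltonian is the Wilson action.

## References

* H.-O. Georgii, *Gibbs Measures and Phase Transitions*, 2nd ed. (de Gruyter 2011), Def. 1.23,
  Rem. 1.24, Def. 2.9, (2.11).
* S. Friedli, Y. Velenik, *Statistical Mechanics of Lattice Systems* (CUP 2017), §6.3.1–6.3.2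
  (Lemma 6.13, Lemma 6.15, eq. (6.10)), §6.10.1.
* E. Seiler, LNP 159 (1982), Ch. 1–2 (Wilson action, finite-volume theory, DLR structure).
* S. Chatterjee, *Yang–Mills for probabilists*, arXiv:1803.01950, §2–3.
-/

noncomputable section

open MeasureTheory Finset Function
open scoped ENNReal
open Literature.Probability.LatticeModels

namespace Literature.MathematicalPhysics.QuantumLattice

/-! ### Full-volume Gibbsian kernels on a finite site set -/

section FiniteVolume

variable {V S : Type*} [MeasurableSpace S]

/-- Gluing a configuration of the WHOLE finite site set with any boundary condition is the
tautological reindexing `(↥univ → S) ≃ (V → S)`, which carries the product measure `ν^{⊗ univ}`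
to the product measure `ν^{⊗ V}` (Georgii 2011, §1.2, `ζ η_{Λᶜ}` with `Λ` the whole site set).
[cite: Georgii2011, §1.2] -/
theorem map_glueWith_univ_pi [Fintype V] (ν : Measure S) [SigmaFinite ν] (η : V → S) :
    (Measure.pi fun _ : ↥(Finset.univ : Finset V) => ν).map (glueWith Finset.univ · η) =
      Measure.pi fun _ : V => ν := by
  symm
  refine Measure.pi_eq fun s hs => ?_
  rw [Measure.map_apply (measurable_glueWith _ η) (MeasurableSet.univ_pi hs)]
  have hpre : (glueWith Finset.univ · η) ⁻¹' Set.pi Set.univ s =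
      Set.pi Set.univ fun i : ↥(Finset.univ : Finset V) => s i := by
    ext ζ
    simp only [Set.mem_preimage, Set.mem_univ_pi]
    constructor
    · intro h i
      have := h i
      rwa [glueWith_apply_mem _ _ _ (Finset.mem_univ (i : V))] at this
    · intro h i
      rw [glueWith_apply_mem _ _ _ (Finset.mem_univ i)]
      exact h ⟨i, Finset.mem_univ i⟩
  rw [hpre, Measure.pi_pi]
  exact Finset.prod_coe_sort Finset.univ fun i => ν (s i)

/-- The full-volume kernel of the Gibbsian specification of a potential on a finite site set is
the product a priori measure tilted by the full Hamiltonian: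
`γ_V(· | η) = Z⁻¹ e^{-β H_V} ν^{⊗V}`, independently of the boundary condition `η`
(Georgii 2011, Def. 2.9 with `Λ = S` finite). [cite: Georgii2011, Def. 2.9] -/
theorem gibbsSpecOfPotential_univ [Fintype V] [DecidableEq V] (ν : Measure S) [SigmaFinite ν]
    (Φ : Potential V S) (supp : Finset V → Finset (Finset V)) (β : ℝ) (η : V → S) :
    gibbsSpecOfPotential ν Φ supp β Finset.univ η =
      (Measure.pi fun _ : V => ν).tilted fun σ => -β * hamiltonianIn Φ supp Finset.univ σ := by
  simp only [gibbsSpecOfPotential, map_glueWith_univ_pi]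

/-- On a finite site set every full-volume kernel `γ_V(· | η)` of a specification is a Gibbs
measure for it: the DLR equation for `Λ ⊆ V` is the consistency `γ_V γ_Λ = γ_V`
(Georgii 2011, Def. 1.23 (iii) with Rem. 1.24). [cite: Georgii2011, Def. 1.23] -/
theorem _root_.Literature.Probability.LatticeModels.IsSpecification.isGibbsMeasure_univ
    [Fintype V] {γ : Specification V S} (hγ : IsSpecification γ) (η : V → S) :
    IsGibbsMeasure γ (γ Finset.univ η) :=
  ⟨hγ.isProbability _ _, fun Λ A hA => hγ.consistent (Finset.subset_univ Λ) η A hA⟩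

/-- **Locality of the Gibbsian kernels** (Friedli–Velenik 2017, eq. (6.10) and Exercise 6.14,
the Markov property of finite-range specifications; Georgii 2011, (2.11)): if the finite-volume
energy `φ` of `Λ` and the observable `F` depend only on the spins in `Λ ∪ T`, then
`η ↦ ∫ F d((ν^{⊗Λ} ∘ glueWith⁻¹(·, η)).tilted φ)` depends only on the spins of `η` in `T`
(the spins in `Λ` are integrated out, those off `Λ ∪ T` are never read).
[cite: FriedliVelenik2017, §6.3.2 eq. (6.10)] -/
theorem dependsOn_integral_tilted_map_glueWith_pi {E : Type*} [NormedAddCommGroup E]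
    [NormedSpace ℝ E] (ν : Measure S) (Λ : Finset V) {T : Set V} {φ : (V → S) → ℝ}
    (hφm : Measurable φ) (hφ : DependsOn φ (↑Λ ∪ T)) {F : (V → S) → E}
    (hFm : StronglyMeasurable F) (hF : DependsOn F (↑Λ ∪ T)) :
    DependsOn (fun η => ∫ σ, F σ ∂(((Measure.pi fun _ : Λ => ν).map (glueWith Λ · η)).tilted φ))
      T := by
  intro η η' hηη'
  -- glued configurations agree on `Λ ∪ T`
  have hg : ∀ ζ : Λ → S, ∀ i ∈ (↑Λ ∪ T : Set V), glueWith Λ ζ η i = glueWith Λ ζ η' i := by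
    intro ζ i hi
    by_cases hiΛ : i ∈ Λ
    · rw [glueWith_apply_mem _ _ _ hiΛ, glueWith_apply_mem _ _ _ hiΛ]
    · rw [glueWith_apply_not_mem _ _ _ hiΛ, glueWith_apply_not_mem _ _ _ hiΛ]
      rcases hi with hi | hi
      · exact absurd (Finset.mem_coe.1 hi) hiΛ
      · exact hηη' i hi
  have hφg : ∀ ζ, φ (glueWith Λ ζ η) = φ (glueWith Λ ζ η') := fun ζ => hφ (hg ζ)
  have hFg : ∀ ζ, F (glueWith Λ ζ η) = F (glueWith Λ ζ η') := fun ζ => hF (hg ζ)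
  -- the normalisers, pulled back to `ν^{⊗Λ}`, agree
  have hZ : ∀ θ : V → S, ∫ σ, Real.exp (φ σ) ∂((Measure.pi fun _ : Λ => ν).map (glueWith Λ · θ)) =
      ∫ ζ, Real.exp (φ (glueWith Λ ζ θ)) ∂(Measure.pi fun _ : Λ => ν) := fun θ =>
    integral_map (measurable_glueWith Λ θ).aemeasurable hφm.exp.aestronglyMeasurable
  have hZ' : ∫ ζ, Real.exp (φ (glueWith Λ ζ η)) ∂(Measure.pi fun _ : Λ => ν) =
      ∫ ζ, Real.exp (φ (glueWith Λ ζ η')) ∂(Measure.pi fun _ : Λ => ν) :=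
    integral_congr_ae (ae_of_all _ fun ζ => by simp only [hφg ζ])
  simp only
  rw [integral_tilted, integral_tilted, hZ η, hZ η', hZ',
    integral_map (measurable_glueWith Λ η).aemeasurable,
    integral_map (measurable_glueWith Λ η').aemeasurable]
  · exact integral_congr_ae (ae_of_all _ fun ζ => by simp only [hφg ζ, hFg ζ])
  all_goals exact ((hφm.exp.div_const _).stronglyMeasurable.smul hFm).aestronglyMeasurable

/-- **Locality of the Gibbsian kernels of a potential** (Friedli–Velenik 2017, eq. (6.10): the
kernel `π_Λ^Φ(· | η)` of a finite-range potential reads `η` only on the interaction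
neighbourhood of `Λ`; Georgii 2011, (2.11)): for an adapted potential `Φ`, if every interaction
set `A ∈ supp Λ` meeting `Λ` lies in `Λ ∪ T` and the observable `F` depends only on the spins in
`Λ ∪ T`, then `η ↦ ∫ F dγ_Λ^Φ(· | η)` depends only on the spins of `η` in `T`.
[cite: FriedliVelenik2017, §6.3.2 eq. (6.10)] -/
theorem dependsOn_integral_gibbsSpecOfPotential [DecidableEq V] {E : Type*}
    [NormedAddCommGroup E] [NormedSpace ℝ E] (ν : Measure S) {Φ : Potential V S}
    (hΦ : Φ.IsAdapted) (supp : Finset V → Finset (Finset V)) (β : ℝ) (Λ : Finset V)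
    {T : Set V} (hT : ∀ A ∈ supp Λ, (A ∩ Λ).Nonempty → (↑A : Set V) ⊆ ↑Λ ∪ T)
    {F : (V → S) → E} (hFm : StronglyMeasurable F) (hF : DependsOn F (↑Λ ∪ T)) :
    DependsOn (fun η => ∫ σ, F σ ∂(gibbsSpecOfPotential ν Φ supp β Λ η)) T := by
  have hH : DependsOn (fun σ => -β * hamiltonianIn Φ supp Λ σ) (↑Λ ∪ T) := by
    intro σ σ' h
    simp only [hamiltonianIn]
    congr 1
    exact Finset.sum_congr rfl fun A hA =>
      (hΦ A).1 fun i hi => h i (hT A (Finset.mem_filter.1 hA).1 (Finset.mem_filter.1 hA).2 hi)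
  unfold gibbsSpecOfPotential
  exact dependsOn_integral_tilted_map_glueWith_pi ν Λ
    ((measurable_hamiltonianIn (fun A => (hΦ A).2) supp Λ).const_mul _) hH hFm hF

/-- For a specification `γ`, a real observable `F` measurable for the product σ-algebra, and a
coordinate set `T` such that `γ_Λ F = (η ↦ ∫ F dγ_Λ(· | η))` depends only on the spins in `T`,
the kernel average `γ_Λ F` is (strongly) measurable for the cylinder σ-algebra `𝓕_T`: it is
`𝓕_{Λᶜ}`-measurable (Georgii 2011, Def. 1.23 (ii); Mathlib `StronglyMeasurable.integral_kernel`),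
hence measurable, and a measurable local function is `𝓕_T`-measurable (Georgii 2011, §1.2).
[cite: Georgii2011, Def. 1.23] -/
theorem _root_.Literature.Probability.LatticeModels.IsSpecification.stronglyMeasurable_cylinderEvents_integral
    {γ : Specification V S} (hγ : IsSpecification γ) (Λ : Finset V) {T : Set V}
    {F : (V → S) → ℝ} (hFm : Measurable F)
    (hdep : DependsOn (fun η => ∫ σ, F σ ∂(γ Λ η)) T) :
    StronglyMeasurable[cylinderEvents (X := fun _ : V => S) T] (fun η => ∫ σ, F σ ∂(γ Λ η)) := by
  have h1 : StronglyMeasurable[cylinderEvents (X := fun _ : V => S) ((↑Λ : Set V)ᶜ)]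
      (fun η => ∫ σ, F σ ∂(γ Λ η)) :=
    hFm.stronglyMeasurable.integral_kernel (κ := hγ.toKernel Λ)
  have h2 : Measurable (fun η => ∫ σ, F σ ∂(γ Λ η)) :=
    h1.measurable.mono cylinderEvents_le_pi le_rfl
  exact (h2.measurable_cylinderEvents_of_dependsOn hdep).stronglyMeasurable

/-- **Markov property of the Gibbsian specification of a finite-range potential**
(Friedli–Velenik 2017, §6.3.1 eq. (6.23) with §6.3.2 eq. (6.10); Georgii 2011, Rem. 1.24 with
(2.11)): for a Gibbs measure `μ` of `γ^{Φ,β}` (countable site set, measurable singletons, nonzero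
finite a priori measure, `Φ` adapted with bounded terms and supported by `supp`), a finite volume
`Λ`, a coordinate set `T` containing every interaction set of `supp Λ` that meets `Λ` (up to `Λ`
itself), and a bounded measurable observable `F` reading only the spins in `Λ ∪ T`, the kernel
average `γ_Λ F` is an `𝓕_T`-measurable version of the conditional expectation
`μ[F | 𝓕_{Λᶜ}]`: conditioning on everything off `Λ` only sees the spins in `T`.
[cite: FriedliVelenik2017, §6.3.1 eq. (6.23)] -/
theorem stronglyMeasurable_and_ae_eq_condExp_integral_gibbsSpecOfPotential [DecidableEq V]
    [Countable V] [MeasurableSingletonClass S] (ν : Measure S) [IsFiniteMeasure ν] [NeZero ν]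
    {Φ : Potential V S} (hΦ : Φ.IsAdapted) (hΦb : ∀ A, ∃ C, ∀ σ, |Φ A σ| ≤ C)
    {supp : Finset V → Finset (Finset V)} (hsupp : Φ.IsSupportedBy supp) (β : ℝ)
    {μ : Measure (V → S)} (hμ : IsGibbsMeasure (gibbsSpecOfPotential ν Φ supp β) μ)
    (Λ : Finset V) {T : Set V} (hT : ∀ A ∈ supp Λ, (A ∩ Λ).Nonempty → (↑A : Set V) ⊆ ↑Λ ∪ T)
    {F : (V → S) → ℝ} (hFm : Measurable F) {C : ℝ} (hC : ∀ σ, |F σ| ≤ C)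
    (hF : DependsOn F (↑Λ ∪ T)) :
    StronglyMeasurable[cylinderEvents (X := fun _ : V => S) T]
        (fun η => ∫ σ, F σ ∂(gibbsSpecOfPotential ν Φ supp β Λ η)) ∧
      (fun η => ∫ σ, F σ ∂(gibbsSpecOfPotential ν Φ supp β Λ η)) =ᵐ[μ]
        μ[F | cylinderEvents (X := fun _ : V => S) ((↑Λ : Set V)ᶜ)] := by
  have hγ := isSpecification_gibbsSpecOfPotential ν hΦ hΦb hsupp β
  exact ⟨hγ.stronglyMeasurable_cylinderEvents_integral Λ hFm
      (dependsOn_integral_gibbsSpecOfPotential ν hΦ supp β Λ hT hFm.stronglyMeasurable hF),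
    (hμ.condExp_ae_eq_integral hγ Λ hFm hC).symm⟩

end FiniteVolume

/-! ### The torus Wilson state as a full-volume Gibbs distribution -/

section Torus

open Literature.MathematicalPhysics.QuantumFieldTheory (Edge GaugeConfig Plaquette wilsonMeasure
  wilsonAction wilsonWeight partitionFunction haarProbability plaquetteHolonomy
  measurable_wilsonAction exists_abs_wilsonAction_le measurable_plaquetteHolonomy
  continuous_trace_re exists_bound_trace_re_nonneg)

variable {d L N : ℕ} {G : Type*} [Group G] [TopologicalSpace G] [IsTopologicalGroup G]
  [CompactSpace G] [MeasurableSpace G] [BorelSpace G] (ρ : G →* Matrix (Fin N) (Fin N) ℂ)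

/-- **The torus Wilson state is a Gibbs reweighting of product Haar measure**:
`μ_{Λ,β} = (Haar^{⊗ links}).tilted (-β S_W)`, i.e. `dμ_{Λ,β} = Z⁻¹ e^{-β S_W} ∏ₑ dU_e` with
`Z = ∫ e^{-β S_W} ∏ₑ dU_e ∈ (0, ∞)` (continuous `ρ`, so the Mathlib `Measure.tilted` junk value is
not hit) (Seiler LNP 159 Ch. 1; Chatterjee arXiv:1803.01950 §2–3).
[cite: arXiv180301950, §2–§3 (lattice gauge theories; the Wilson action)] -/
theorem wilsonMeasure_eq_tilted_pi [NeZero L] [SecondCountableTopology G] (hρ : Continuous ρ)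
    (β : ℝ) :
    wilsonMeasure (d := d) (L := L) ρ β =
      (Measure.pi fun _ : Edge d L => haarProbability G).tilted fun U => -β * wilsonAction ρ U := by
  set π : Measure (GaugeConfig d L G) := Measure.pi fun _ : Edge d L => haarProbability G with hπ
  haveI : IsProbabilityMeasure π := by rw [hπ]; infer_instance
  have hwm : Measurable fun U : GaugeConfig d L G => Real.exp (-β * wilsonAction ρ U) :=
    ((measurable_wilsonAction ρ hρ).const_mul _).exp
  obtain ⟨B, hB⟩ := exists_abs_wilsonAction_le (d := d) (L := L) ρ hρ
  have hint : Integrable (fun U : GaugeConfig d L G => Real.exp (-β * wilsonAction ρ U)) π := by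
    refine Integrable.of_bound hwm.aestronglyMeasurable (Real.exp (|β| * B))
      (ae_of_all _ fun U => ?_)
    rw [Real.norm_eq_abs, Real.abs_exp, Real.exp_le_exp]
    have h : |β * wilsonAction ρ U| ≤ |β| * B := by
      rw [abs_mul]; exact mul_le_mul_of_nonneg_left (hB U) (abs_nonneg _)
    have := (abs_le.1 h).1
    linarith
  have hZ : partitionFunction (d := d) (L := L) ρ β =
      ENNReal.ofReal (∫ U, Real.exp (-β * wilsonAction ρ U) ∂π) := by
    rw [ofReal_integral_eq_lintegral_ofReal hint (ae_of_all _ fun U => (Real.exp_pos _).le)]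
    simp only [partitionFunction, wilsonWeight, withDensity_apply _ MeasurableSet.univ,
      Measure.restrict_univ, hπ]
  have hZpos : 0 < ∫ U, Real.exp (-β * wilsonAction ρ U) ∂π := integral_exp_pos hint
  have hdens : (fun U : GaugeConfig d L G => ENNReal.ofReal
      (Real.exp (-β * wilsonAction ρ U) / ∫ V, Real.exp (-β * wilsonAction ρ V) ∂π)) =
      (ENNReal.ofReal (∫ V, Real.exp (-β * wilsonAction ρ V) ∂π))⁻¹ •
        fun U => ENNReal.ofReal (Real.exp (-β * wilsonAction ρ U)) := by
    funext U
    simp only [Pi.smul_apply, smul_eq_mul]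
    rw [div_eq_mul_inv, ENNReal.ofReal_mul (Real.exp_pos _).le, ENNReal.ofReal_inv_of_pos hZpos,
      mul_comm]
  rw [Measure.tilted, hdens, withDensity_smul' _ _
      (ENNReal.inv_ne_top.2 (ENNReal.ofReal_pos.2 hZpos).ne'), wilsonMeasure, hZ, wilsonWeight]

/-- **The Wilson action is the full-volume Hamiltonian of the plaquette potential** (Wilson 1974;
Seiler LNP 159 Ch. 1–2; Chatterjee arXiv:1803.01950 §3, `S_Λ(U) = ∑_{p ∈ P(Λ)} Re tr(I − U_p)`):
on the torus there is an interaction potential `Φ` on the link set, supported by the finite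
family of edge sets of plaquettes, with `Φ_A = ∑_{p : edges(p) = A} (N − Re tr ρ(U_p))`, which is
adapted (each `Φ_A` reads only the links in `A` and is measurable), has bounded terms, and whose
full-volume Hamiltonian is the Wilson action `S_W`; every interaction set is the edge set
`{(y,i), (y+eᵢ,j), (y+eⱼ,i), (y,j)}` of a plaquette `(y, i < j)`.
[cite: arXiv180301950, §2–§3 (lattice gauge theories; the Wilson action)] -/
theorem exists_plaquettePotential [NeZero L] [SecondCountableTopology G] (hρ : Continuous ρ) :
    ∃ (Φ : Potential (Edge d L) G) (supp : Finset (Edge d L) → Finset (Finset (Edge d L))),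
      Φ.IsAdapted ∧ (∀ A, ∃ C, ∀ U, |Φ A U| ≤ C) ∧ Φ.IsSupportedBy supp ∧
      (∀ U, hamiltonianIn Φ supp Finset.univ U = wilsonAction ρ U) ∧
      (∀ Λ, ∀ A ∈ supp Λ, ∃ (y : QuantumFieldTheory.Site d L) (i j : Fin d), i < j ∧
        A = {(y, i), (y.shift i, j), (y.shift j, i), (y, j)}) := by
  -- edge sets and costs of the torus plaquettes
  set E : Plaquette d L → Finset (Edge d L) := fun p =>
    {(p.1, p.2.1.1), (p.1.shift p.2.1.1, p.2.1.2), (p.1.shift p.2.1.2, p.2.1.1), (p.1, p.2.1.2)}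
    with hE
  set c : Plaquette d L → GaugeConfig d L G → ℝ := fun p U =>
    (N : ℝ) - (ρ (plaquetteHolonomy U p.1 p.2.1.1 p.2.1.2)).trace.re with hc
  obtain ⟨M, -, hM⟩ := exists_bound_trace_re_nonneg ρ hρ
  refine ⟨fun A U => ∑ p : Plaquette d L with E p = A, c p U, fun _ => Finset.univ.image E,
    fun A => ⟨?_, ?_⟩, fun A => ?_, fun Λ A _ hne => ?_, fun U => ?_, fun Λ A hA => ?_⟩
  · -- `Φ_A` reads only the links in `A`
    intro U V h
    refine Finset.sum_congr rfl fun p hp => ?_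
    have hpA : E p = A := (Finset.mem_filter.1 hp).2
    have h' : ∀ e ∈ E p, U e = V e := fun e he => h e (by rw [← hpA]; exact he)
    simp only [hc, plaquetteHolonomy]
    rw [h' _ (by simp [hE]), h' (p.1.shift p.2.1.1, p.2.1.2) (by simp [hE]),
      h' (p.1.shift p.2.1.2, p.2.1.1) (by simp [hE]), h' (p.1, p.2.1.2) (by simp [hE])]
  · -- measurability
    refine Finset.measurable_sum _ fun p _ => ?_
    exact measurable_const.sub
      ((continuous_trace_re ρ hρ).measurable.comp (measurable_plaquetteHolonomy _ _ _))
  · -- bounded terms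
    refine ⟨∑ p : Plaquette d L with E p = A, ((N : ℝ) + M), fun U => ?_⟩
    refine (Finset.abs_sum_le_sum_abs _ _).trans (Finset.sum_le_sum fun p _ => ?_)
    refine (abs_sub _ _).trans ?_
    rw [Nat.abs_cast]
    exact add_le_add le_rfl (hM _)
  · -- supported by the edge sets of plaquettes
    by_contra hA
    refine hne (funext fun U => Finset.sum_eq_zero fun p hp => ?_)
    exact absurd (Finset.mem_image.2 ⟨p, Finset.mem_univ _, (Finset.mem_filter.1 hp).2⟩) hA
  · -- the full-volume Hamiltonian is the Wilson action
    unfold hamiltonianIn wilsonAction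
    rw [Finset.filter_true_of_mem fun A hA => ?_]
    · exact Finset.sum_fiberwise_of_maps_to (fun p _ => Finset.mem_image_of_mem E (Finset.mem_univ p)) _
    · obtain ⟨p, -, rfl⟩ := Finset.mem_image.1 hA
      exact ⟨(p.1, p.2.1.1), by simp [hE]⟩
  · -- interaction sets are edge sets of plaquettes
    obtain ⟨p, -, rfl⟩ := Finset.mem_image.1 hA
    exact ⟨p.1, p.2.1.1, p.2.1.2, p.2.2, rfl⟩

/-- **The torus Wilson state is the full-volume Gibbs distribution of the plaquette potential**
(Seiler LNP 159 Ch. 2; Georgii 2011, Def. 2.9): for every bounded adapted finitely supported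
potential `Φ` on the links of the torus whose full-volume Hamiltonian is the Wilson action,
`μ_{Λ,β} = γ^{Φ,β}_{univ}(· | η)` for every boundary condition `η` (there is no boundary).
[cite: Georgii2011, Def. 2.9] -/
theorem wilsonMeasure_eq_gibbsSpecOfPotential_univ [NeZero L] [SecondCountableTopology G]
    (hρ : Continuous ρ) {Φ : Potential (Edge d L) G}
    {supp : Finset (Edge d L) → Finset (Finset (Edge d L))}
    (hH : ∀ U, hamiltonianIn Φ supp Finset.univ U = wilsonAction ρ U) (β : ℝ)
    (η : GaugeConfig d L G) :
    wilsonMeasure (d := d) (L := L) ρ β = gibbsSpecOfPotential (haarProbability G) Φ supp β Finset.univ η := by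
  rw [gibbsSpecOfPotential_univ, wilsonMeasure_eq_tilted_pi ρ hρ β]
  simp only [hH]

/-- **The torus Wilson state is a DLR state of the plaquette specification** (Seiler LNP 159
Ch. 2, DLR equations in finite volume; Georgii 2011, Def. 1.23 with Rem. 1.24 and Def. 2.9):
for a compact metrisable gauge group with a continuous representation `ρ` and every bounded
adapted finitely supported potential `Φ` on the links of the torus whose full-volume Hamiltonian
is the Wilson action, `wilsonMeasure ρ β ∈ 𝒢(γ^{Φ,β})`.  In particular the kernels
`γ^{Φ,β}_Λ f` are versions of the conditional expectations `E_{μ_{Λ,β}}[f | links off Λ]`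
(`IsGibbsMeasure.condExp_ae_eq_integral`). [cite: Georgii2011, Def. 1.23] -/
theorem isGibbsMeasure_wilsonMeasure [NeZero L] [T2Space G] [SecondCountableTopology G]
    (hρ : Continuous ρ) {Φ : Potential (Edge d L) G} (hΦ : Φ.IsAdapted)
    (hΦb : ∀ A, ∃ C, ∀ U, |Φ A U| ≤ C) {supp : Finset (Edge d L) → Finset (Finset (Edge d L))}
    (hsupp : Φ.IsSupportedBy supp) (hH : ∀ U, hamiltonianIn Φ supp Finset.univ U = wilsonAction ρ U)
    (β : ℝ) :
    IsGibbsMeasure (gibbsSpecOfPotential (haarProbability G) Φ supp β)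
      (wilsonMeasure (d := d) (L := L) ρ β) := by
  rw [wilsonMeasure_eq_gibbsSpecOfPotential_univ ρ hρ hH β (Classical.arbitrary _)]
  exact (isSpecification_gibbsSpecOfPotential (haarProbability G) hΦ hΦb hsupp β).isGibbsMeasure_univ _

end Torus

end Literature.MathematicalPhysics.QuantumLattice
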